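import Summits.MatrixMultiplication.MatrixMultiplication.Theorems.GradedDesignFamily.Negative.SubfieldCellNineRowThreeFifteenCert

/-!
# Subfield cell `GL₂(𝔽₉) ⊃ SL₂(𝔽₃)` at level one — IX-e: the row-three certificate at β = 3, part 5 of 5

**Honest framing.** VALUE = a kernel-checked finite certificate about ONE finite cell of ONE
skeleton line (`quadratic_extension_level_one_cell`, stub S3 `stub_subfieldCell`, crux
`GradedDesignFamily`, route `LevelGradedCohnUmans`).  It is **not** progress on
`Summit.MatrixMultiplication` and does **not** refute `stub_subfieldCell`.

The checker `checkRep15` of file IX (`SubfieldCellNineRowThreeFifteenCert`) on the representatives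
`478 … 542` of `repsC`; see that file for the semantics and file X for the soundness proof.
-/

set_option linter.dupNamespace false

namespace Summit.MatrixMultiplication.MatrixMultiplication.Theorems.GradedDesignFamily.Negative.SubfieldNine

/-- **The β = 3 certificate, part 5 of 5** (representatives `478 … 542`). -/
theorem fact_row3f5 : ((repsC.drop 478).all checkRep15) = true := by
  native_decide

end Summit.MatrixMultiplication.MatrixMultiplication.Theorems.GradedDesignFamily.Negative.SubfieldNine
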